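import Mathlib
import Summits.Ventures.HodgeRepro2.T5EpsilonKudla
import Summits.Ventures.HodgeRepro2.T5SelfDualGaussSum
import Summits.Ventures.HodgeRepro2.T5LocalFieldHaar

/-!
# (T1) on the local-field object with Kudla's self-dual normalisation — the end-to-end composition

Blind cell `pub-hodge-repro2`, seat p7 (gen 9), Tier-5 kernel support for N5 / §G [R-4]
(route/T5-CHECK-G-p7.md §4 «TATE HALF»; route/T5-LEAN-p7.md §12, §21, §24, §26, §27).

`T5EpsilonKudla.epsShape_mul_epsShape_inv_kudlaZ` (row 27) proves the ε-factor identity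
`ε(s, ω, ψ) · ε(1 − s, ω⁻¹, ψ) = ω(m1)` from Kudla's printed shape of `ε` with the Gauss sums
`G(ω^{±1}|_U)` read as `kudlaGaussSumZ` — the integral against a PROBABILITY Haar measure of an
abstract DVR with a `Fintype` quotient and a `MeasurableSet` ideal.  This file composes it with
row 30 (`T5SelfDualGaussSum`: Kudla's own normalisation, `dy` self-dual with `vol(𝒪) = q^{−ν/2}`
and prefactor `q^{½(ν+c)}`) and row 29 (`T5LocalFieldHaar`: Mathlib's local-field object, where
every measure hypothesis is discharged):

* `epsShape_mul_epsShape_inv_selfDual` — (T1) for an abstract DVR with the Gauss sums in the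
  self-dual normalisation (hypotheses: `|𝒪/𝔭^{m+1}| = q^{m+1}`, `q > 0`);
* `epsShape_mul_epsShape_inv_localField` — (T1) on `𝒪[K]` (`K` Mathlib's local-field object,
  `q = |𝓀[K]|`): the cardinality, positivity, measurability, probability, invariance and
  finiteness hypotheses are ALL discharged; what remains are the printed-shape data of row 13
  (`epsShape` — Kudla Prop. 3.8 (i)/(ii)), the conductor of `ω'` (p4's `conductor`), the conductor
  of `Ψ` (trivial on `ϖ^{−ν}𝒪`, non-trivial on `ϖ^{−ν−1}𝒪`), the identification of the printed
  `G(ω^{±1}|_U)` with Kudla's integral (`hG`, `hG'`) and `ω(m1) = ω'(−1)` (`hm`).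

What stays prose: exactly the readings of print in route/T5-LEAN-p7.md §22(b)(i)–(iii) and
«`F_v` is Mathlib's local-field object» (§22, second addendum).
README §8(d): uses an L-value-free non-vanishing device: NO.
-/

namespace Summit.Ventures.HodgeRepro2.T5EpsilonLocalField

open MeasureTheory Ideal
open Summit.Ventures.HodgeRepro2

section Abstract

variable {𝒪 : Type*} [CommRing 𝒪] [IsDomain 𝒪] [IsDiscreteValuationRing 𝒪] {ϖ : 𝒪} {m : ℕ}
  [MeasurableSpace 𝒪] [MeasurableAdd 𝒪] (μ : Measure 𝒪) [μ.IsAddLeftInvariant]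
  [IsProbabilityMeasure μ] [Fintype (𝒪 ⧸ span {ϖ ^ (m + 1)})]
  {K : Type*} [Field K] [Algebra 𝒪 K] [IsFractionRing 𝒪 K] {Kx : Type*} [CommGroup Kx]

/-- **(T1) with the Gauss sums in Kudla's self-dual normalisation**: row 27's identity with
`G(ω^{±1}|_U) = kudlaGaussSumSelfDual μ q ν …` (prefactor `q^{½(ν+c)}`, measure `q^{−ν/2} dy₀`),
`|𝒪/𝔭^{m+1}| = q^{m+1}`, `ω'` of conductor exactly `𝔭^{m+1}`, `Ψ` of conductor exactly
`𝔭^{−ν}`. -/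
theorem epsShape_mul_epsShape_inv_selfDual
    (hI : MeasurableSet ((span {ϖ ^ (m + 1)} : Ideal 𝒪) : Set 𝒪)) (hϖ : Irreducible ϖ)
    (U : Subgroup Kx) (ϖ' : Kx) {q : ℝ} (hq : 0 < q)
    (hcard : (Fintype.card (𝒪 ⧸ span {ϖ ^ (m + 1)}) : ℝ) = q ^ (m + 1)) (ν : ℕ) (n : ℤ)
    (c : (Kx →* ℂˣ) → ℕ) (G : (U →* ℂˣ) → ℂ) (s : ℂ) (ω : Kx →* ℂˣ) (m1 : Kx)
    (hc : c ω⁻¹ = c ω) {ω' : 𝒪ˣ →* ℂˣ}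
    (hex : ∃ n, T5PrincipalUnitFiltration.higherUnits ϖ n ≤ ω'.ker)
    (hω : T5ConductorArithmetic.conductor (T5PrincipalUnitFiltration.higherUnits ϖ) ω' = m + 1)
    (h₁ : T5PrincipalUnitFiltration.higherUnits ϖ (m + 1) ≤ ω'.ker)
    (h₂ : T5PrincipalUnitFiltration.higherUnits ϖ (m + 1) ≤ ω'⁻¹.ker)
    (Ψ : AddChar K ℂ)
    (hΨ : ∀ x : 𝒪, Ψ (algebraMap 𝒪 K x *
      algebraMap 𝒪 K ϖ ^ (((m + 1 : ℕ) : ℤ) - ((ν + (m + 1) : ℕ) : ℤ))) = 1)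
    {y : 𝒪} (hy : Ψ (algebraMap 𝒪 K y *
      algebraMap 𝒪 K ϖ ^ ((m : ℤ) - ((ν + (m + 1) : ℕ) : ℤ))) ≠ 1)
    (hG : G (ω.restrict U) = T5SelfDualGaussSum.kudlaGaussSumSelfDual μ q ν hϖ ω' h₁ Ψ)
    (hG' : G (ω⁻¹.restrict U) = T5SelfDualGaussSum.kudlaGaussSumSelfDual μ q ν hϖ ω'⁻¹ h₂ Ψ)
    (hm : (ω m1 : ℂ) = (ω' (-1) : ℂ)) :
    T5EpsilonTwist.epsShape U ϖ' (q : ℂ) n c G s ω *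
        T5EpsilonTwist.epsShape U ϖ' (q : ℂ) n c G (1 - s) ω⁻¹ = (ω m1 : ℂ) := by
  have hq' : (q : ℂ) ≠ 0 := by exact_mod_cast hq.ne'
  rw [T5SelfDualGaussSum.kudlaGaussSumSelfDual_eq μ hq ν hcard hϖ ω' h₁ Ψ] at hG
  rw [T5SelfDualGaussSum.kudlaGaussSumSelfDual_eq μ hq ν hcard hϖ ω'⁻¹ h₂ Ψ] at hG'
  exact T5EpsilonKudla.epsShape_mul_epsShape_inv_kudlaZ μ hI hϖ U ϖ' hq' n c G s ω m1 hc hex hω Ψ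
    _ hΨ hy hG hG' hm

end Abstract

section LocalField

open scoped NormedField Valued

variable {K : Type*} [NontriviallyNormedField K] [IsUltrametricDist K] [CompleteSpace K]
  [IsDiscreteValuationRing 𝒪[K]] [Finite 𝓀[K]] [MeasurableSpace K] [BorelSpace K]
  {ϖ : 𝒪[K]} {m : ℕ} {Kx : Type*} [CommGroup Kx]

omit [CompleteSpace K] [Finite 𝓀[K]] [MeasurableSpace K] [BorelSpace K] in
/-- `|𝒪[K]/(ϖ^{m+1})| = |𝓀[K]|^{m+1}` in the real-cast form the self-dual file takes. -/
theorem card_quot_eq_card_residueField_pow (hϖ : Irreducible ϖ)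
    [Fintype (𝒪[K] ⧸ span {ϖ ^ (m + 1)})] :
    (Fintype.card (𝒪[K] ⧸ span {ϖ ^ (m + 1)}) : ℝ) = (Nat.card 𝓀[K] : ℝ) ^ (m + 1) := by
  rw [← Nat.card_eq_fintype_card, T5LocalFieldHaar.card_quot_span_pow hϖ (m + 1)]
  push_cast
  rfl

omit [CompleteSpace K] [IsDiscreteValuationRing 𝒪[K]] [MeasurableSpace K] [BorelSpace K] in
/-- `q = |𝓀[K]| > 0`. -/
theorem card_residueField_pos : (0 : ℝ) < (Nat.card 𝓀[K] : ℝ) := by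
  exact_mod_cast Nat.card_pos

/-- **(T1) on Mathlib's local-field object, Kudla's normalisation**: for `K` complete ultrametric
with `𝒪[K]` a DVR with finite residue field `𝓀[K]`, `q = |𝓀[K]|`, `dy` the self-dual measure
`q^{−ν/2} · haar` and `𝔤 = q^{½(ν+c)} ∫_{𝒪[K]} …` — every hypothesis on the measure, the
cardinality and the finiteness of the quotient is DISCHARGED; the remaining hypotheses are the
printed-shape data of row 13, the two conductor conditions, the identification `hG` / `hG'` of
the printed Gauss sums with Kudla's integral, and `ω(m1) = ω'(−1)`. -/
theorem epsShape_mul_epsShape_inv_localField (hϖ : Irreducible ϖ)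
    [Fintype (𝒪[K] ⧸ span {ϖ ^ (m + 1)})] (U : Subgroup Kx) (ϖ' : Kx) (ν : ℕ) (n : ℤ)
    (c : (Kx →* ℂˣ) → ℕ) (G : (U →* ℂˣ) → ℂ) (s : ℂ) (ω : Kx →* ℂˣ) (m1 : Kx)
    (hc : c ω⁻¹ = c ω) {ω' : 𝒪[K]ˣ →* ℂˣ}
    (hex : ∃ n, T5PrincipalUnitFiltration.higherUnits ϖ n ≤ ω'.ker)
    (hω : T5ConductorArithmetic.conductor (T5PrincipalUnitFiltration.higherUnits ϖ) ω' = m + 1)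
    (h₁ : T5PrincipalUnitFiltration.higherUnits ϖ (m + 1) ≤ ω'.ker)
    (h₂ : T5PrincipalUnitFiltration.higherUnits ϖ (m + 1) ≤ ω'⁻¹.ker)
    (Ψ : AddChar K ℂ)
    (hΨ : ∀ x : 𝒪[K], Ψ (algebraMap 𝒪[K] K x *
      algebraMap 𝒪[K] K ϖ ^ (((m + 1 : ℕ) : ℤ) - ((ν + (m + 1) : ℕ) : ℤ))) = 1)
    {y : 𝒪[K]} (hy : Ψ (algebraMap 𝒪[K] K y *
      algebraMap 𝒪[K] K ϖ ^ ((m : ℤ) - ((ν + (m + 1) : ℕ) : ℤ))) ≠ 1)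
    (hG : G (ω.restrict U) = T5SelfDualGaussSum.kudlaGaussSumSelfDual (T5LocalFieldHaar.haar (K := K))
      (Nat.card 𝓀[K] : ℝ) ν hϖ ω' h₁ Ψ)
    (hG' : G (ω⁻¹.restrict U) = T5SelfDualGaussSum.kudlaGaussSumSelfDual
      (T5LocalFieldHaar.haar (K := K)) (Nat.card 𝓀[K] : ℝ) ν hϖ ω'⁻¹ h₂ Ψ)
    (hm : (ω m1 : ℂ) = (ω' (-1) : ℂ)) :
    T5EpsilonTwist.epsShape U ϖ' ((Nat.card 𝓀[K] : ℝ) : ℂ) n c G s ω *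
        T5EpsilonTwist.epsShape U ϖ' ((Nat.card 𝓀[K] : ℝ) : ℂ) n c G (1 - s) ω⁻¹ =
      (ω m1 : ℂ) :=
  epsShape_mul_epsShape_inv_selfDual (T5LocalFieldHaar.haar (K := K))
    (T5LocalFieldHaar.measurableSet_span_pow (m + 1)) hϖ U ϖ' card_residueField_pos
    (card_quot_eq_card_residueField_pow hϖ) ν n c G s ω m1 hc hex hω h₁ h₂ Ψ hΨ hy hG hG' hm

end LocalField

end Summit.Ventures.HodgeRepro2.T5EpsilonLocalField
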